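import Literature.MathematicalPhysics.QuantumFieldTheory.Balaban1983to89.B1RTSemigroup
import Literature.MathematicalPhysics.QuantumFieldTheory.Balaban1983to89.B1RG242
import Literature.MathematicalPhysics.QuantumFieldTheory.Balaban1983to89.Beta.GaussianIntegral

/-!
# `Balaban1983to89.B1Eq239Normalization` — T. Bałaban, *(Higgs)₂,₃ quantum fields in a finite volume. I. A lower bound*, Commun. Math. Phys. **85** (1982) 603–626 [Balaban1982Higgs1]: the recursion (2.39) and the product formula (2.40) for the normalisation factors Z^ε_k, Z^{(k),L^kε} of (2.18)/(2.19), TYPED and PROVED — at the level of the operators (2.4) (from the semigroup law (2.14)/(2.16)) and at the level of the Gaussian closed forms (a Schur-complement determinant identity over `B1RG242.StepData`)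

statement-level skeleton of published theorems with citation tags; proofs where landed; nothing here is a claim about the Yang–Mills mass gap

PDF held: `paper:balaban1982-cmp85-higgs23-i` (journal page = PDF page + 602); pp. 610–612 [PDF 8–10] and p. 617
[PDF 15] read from the ×2 renders `…/pages/1982-cmp85-higgs23-I/1982-cmp85-higgs23-I-p008-x2.png`, `-p009-x2.png`,
`-p010-x2.png`, `-p015-x2.png` of the cell `pub-balaban`, READ AS IMAGES.

CITATION HEADER — WHAT IS REPRODUCED.  SKELETON row **B1.Eq2.39-2.40** of `run/shared/lean/pub/lit-balaban/SKELETON.md`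
(`absent (bookkeeping identity; not cited later)` through v3.6; `B1RG242` header, item (ii): "the determinant
identities (2.39)/(2.40) (normalisation factors) — not typed").  p. 612 [PDF 10], verbatim: *"Now we will find recursive
relations between the propagators (2.20), (2.30). Using the relations (2.18), (2.19), (2.21), we get after easy
calculations  Z^ε_{k+1}(Ω,A) = Z^ε_k(Ω,A)Z^{(k),L^kε}(Ω,A), (2.39)
Z^ε_k(Ω,A) = Z^{(k−1),L^{k−1}ε}(Ω,A)·…·Z^{(1),Lε}(Ω,A)Z^{(0),ε}(Ω,A), (2.40)"* (followed by (2.41), (2.42) =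
`B1RG242.StepData.display241/242`).  The definitions it refers to, p. 610 [PDF 8], verbatim: *"We define inductively
Δ^{(0),ε}(Ω,A) = −Δ^{ε,N}_{A,Ω} + m², (2.17)  Z^{(k),L^kε}(Ω,A) exp(−½⟨ψ,Δ^{(k+1),L^{k+1}ε}(Ω,A)ψ⟩)
= T^{L^kε}_{a,L,A}[Ω^{(k)}, exp(−½⟨φ,Δ^{(k),L^kε}(Ω,A)φ⟩)]. (2.18)  From (2.16) we have
Z^ε_k(Ω,A) exp(−½⟨ψ,Δ^{(k),L^kε}(Ω,A)ψ⟩) = T^ε_{a_k,L^k,A}[Ω, exp(−½⟨φ,(−Δ^{ε,N}_{A,Ω}+m²)φ⟩)]. (2.19)  Defining the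
propagator G^ε_k(Ω,A) = (−Δ^{ε,N}_{A,Ω} + m² + a_k(L^kε)^{−2}P_k(A))^{−1}, P_k(A) = Q^*_k(A)Q_k(A), (2.20) and calculating
the integral in (2.19), we obtain ⟨ψ,Δ^{(k),L^kε}(Ω,A)ψ⟩ = a_k(L^kε)^{−2}⟨ψ,ψ⟩ − a_k²(L^kε)^{−4}⟨ψ,Q_k(A)G^ε_k(Ω,A)Q^*_k(A)ψ⟩.
(2.21)"*; p. 611 [PDF 9]: *"We define a convariance [sic] C^{(k),L^kε}(Ω,A) by means of the quadratic form in φ in this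
integral: C^{(k),L^kε}(Ω,A) = (a(L^{k+1}ε)^{−2}P(A) + Δ^{(k),L^kε}(Ω,A))^{−1}. (2.30)"*; p. 617 [PDF 15], the closed form
of Z^ε_k printed in §3: *"Z_k(A^{(k),ε}) = (a_k(L^kε)^{d−2}/2π)^{(N/2)|T₁^{(k)}|} ∫dφ exp(−½⟨φ,(G^ε_k(A^{(k),ε}))^{−1}φ⟩).
(3.32)"* (the exponent counts the N|T^{(k)}| OUTPUT variables ψ, the integral runs over the INPUT ε-lattice fields φ).

DICTIONARY AND WHAT IS KERNEL-CHECKED.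
 §1 (operators, over unit r14's carriers `B1RT.rtOp` (2.4), `B1RT.blockKernel` (2.5)/(2.10), `B1RTSemigroup.qAvg` (2.7),
    `B1RTSemigroup.rtChain`/`chainAvg`/`precSeq` (2.16)):  Z of (2.18)/(2.19) ↦ `normConst t ρ := (Tρ)(0)` — (2.18) resp.
    (2.19) READ AT ψ = 0, where the Gaussian factor exp(−½⟨ψ,Δψ⟩) is 1; the Gaussian density exp(−½⟨ψ,Δ^{(k)}ψ⟩) that
    (2.18)/(2.19) define ↦ `normShape t ρ := Tρ/(Tρ)(0)`; ρ ↤ exp(−½⟨φ,(−Δ^{ε,N}_{A,Ω}+m²)φ⟩) (any non-negative integrable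
    density of positive mass with ρ(0) > 0, resp. = 1).  PROVED: `normConst_comp` — (2.39) from (2.14), (2.18), (2.19) for
    ANY three transformations with T₂T₁ = T₃ (the "easy calculation": T₃ρ = T₂(Z₁·g) = Z₁·T₂g at ψ = 0);  **`display239`**
    — (2.39) `Z^ε_{k+1} = Z^ε_k · Z^{(k),L^kε}` for T_k (kernel (2.10), precision β, block averages Q_k(A) = `m`), T^{(k)}
    (kernel (2.6), precision α, Q(A) = `qAvg w u`) and T_{k+1} = their composition with precision `compPrec α β w |B|`
    (2.13) and Q_{k+1}(A) = Q(A)Q_k(A), by r14's PROVED semigroup law `B1RTSemigroup.display214` (2.14); the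
    non-vanishing of Z^ε_k is a hypothesis in `display239` and DISCHARGED in `display239_of_nonneg` (`rtOp_blockKernel_pos`:
    a Gaussian transformation of a non-negative integrable density of positive mass is everywhere > 0);  **`display240`**
    — (2.40) `Z^ε_k = Z^{(k−1),L^{k−1}ε}·…·Z^{(1),Lε}Z^{(0),ε}` for the printed data (|B| = L^d, weight L^{−d}, constants
    a(L^jε)^{d−2}, the k-chain being T^ε_{a_k,L^k,A} by r14's `display216` (2.16)), the factors being the list
    `chainConsts` (coarsest first, as printed: each = the one-step transformation applied to the normalised previous
    density, at ψ = 0 — (2.18)), general form `rtChain_apply_zero_eq_prod` (induction, each step = (2.39),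
    `rtChain_succ_apply_zero`).
 §2 (determinants, over unit r14's `B1RG242.StepData` S — H ↤ −Δ^{ε,N}_{A,Ω}+m², Qk/Qks ↤ Q_k(A)/Q^*_k(A), Q/Qs ↤
    Q(A)/Q^*(A), α ↤ a_k(L^kε)^{−2}, β ↤ a(L^{k+1}ε)^{−2}, γ = αβ/(α+β) ↤ a_{k+1}(L^{k+1}ε)^{−2}, `Pk`, `P`, `Gk` (2.20), `Δk`
    (2.21), `Ck` (2.30), `Pk1` — any field 𝕜, any finite carriers):  `jointForm S` ↦ the matrix
    [[H + αP_k, −αQ^*_k], [−αQ_k, α·1 + βP]] of the exponent of the composite integrand T^{(k)}T_k[e^{−½⟨φ,Hφ⟩}] in (φ, θ)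
    at ψ = 0.  PROVED: `det_jointForm_fst` (Schur complement of H + αP_k is βP + Δ^{(k)} = (C^{(k)})⁻¹ — (2.21) inserted in
    (2.30)), `det_jointForm_snd` (Schur complement of α·1 + βP is H + γP_{k+1} = (G^ε_{k+1})⁻¹ — the operator content of
    (2.12)/(2.14)), `det_smul_one_add_smul_P` (det(α·1 + βQ^*Q)·α^{|ν|} = α^{|κ|}(α+β)^{|ν|}, Weinstein–Aronszajn), hence
    **`det_display239`**: `det(H + αP_k)·det(βP + Δ^{(k)})·α^{|ν|} = α^{|κ|}(α+β)^{|ν|}·det(H + γP_{k+1})` under QQ^* = 1,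
    α ≠ 0, α + β ≠ 0, H + αP_k invertible (the invertibility of βP + Δ^{(k)} is NOT assumed).
 §3 (Gaussian closed forms over ℝ):  `zConst c nOut M := (c/2π)^{nOut/2} ∫_{ι→ℝ} exp(−½vᵀMv) dv` — (2.18)/(2.19) at ψ = 0
    in integration coordinates (c = the kernel constant of (2.6)/(2.10), nOut = the number of real OUTPUT variables, M =
    the matrix of the exponent at ψ = 0 on the INPUT variables; for nOut = |ι| it is, definitionally, seat p12's
    `B1GaussNorm331.gaussNorm` of (3.31)/(3.32) — not imported here); `zConst_closedForm`/`zConst_sq`/`zConst_pos` from the tree's KERNEL Gaussian integral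
    `Beta.GaussianIntegral.integral_exp_neg_half_quadForm` BY NAME;  **`zConst_display239`**: with the scalar products
    (1.5) encoded by a weight matrix `WE` (ε-lattice) and scalar weights `wK` = (L^kε)^d, `wM` = (L^{k+1}ε)^d (so that
    a_k(L^kε)^{d−2} = α·wK, a(L^{k+1}ε)^{d−2} = β·wM, a_{k+1}(L^{k+1}ε)^{d−2} = γ·wM), QQ^* = 1, α, β > 0 and the three
    forms positive definite:  `Z^ε_k · Z^{(k),L^kε} = Z^ε_{k+1}` for the closed forms — (2.39) with every constant and
    every power of 2π accounted for (`det_display239` + γ(α+β) = αβ = `B1RG242.StepData.γ_mul`).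
NOT CERTIFIED HERE, AND HOW IT IS LABELLED.  (i) The identification of §1's `normConst` (an integral over `X → V` for
the pi-Lebesgue measure of r14's carriers) with §3's `zConst` (an integral over `ι → ℝ`) — the measure-preserving
coordinates (X → V) ≃ (ι → ℝ) and the matrix of ⟨·,·⟩_ε in them — [folklore: finite-dimensional Gaussian integration],
exactly the dictionary item (i) left open in `B1RG242`; §1 and §2–§3 are two independent kernel certificates of the
same printed line.  (ii) (2.21) itself ("calculating the integral in (2.19)") is not re-derived: §1 needs only the
VALUE AT 0 of the Gaussians (2.18)/(2.19) (= 1), never their quadratic forms; §2 takes Δ^{(k)} := `B1RG242.StepData.Δk`.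
(iii) QQ^* = 1, adjointness/positivity are HYPOTHESES, as in `B1RG242` (D-pv07.12).
Unit `lit-balaban-p15` (Phase-2 seat p15, referee ref-4), HOME `run/shared/lean/pub/lit-balaban/` (`lit-balaban-p15/STATUS.md`).
-/

open scoped BigOperators
open _root_.MeasureTheory _root_.Real

namespace Literature.MathematicalPhysics.QuantumFieldTheory.Balaban1983to89.B1Eq239Normalization

/-! ## §1  (2.18), (2.19), (2.39), (2.40) at the level of the operators (2.4) -/

section Operator

open B1RT B1RTSemigroup

variable {V : Type*} [NormedAddCommGroup V] [InnerProductSpace ℝ V] [FiniteDimensional ℝ V]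
  [MeasurableSpace V] [BorelSpace V]
variable {X Y W : Type*} [Fintype X] [Fintype Y]

/-- **The normalisation factor of (2.18)/(2.19)**: for a transformation `T` with kernel `t` (2.4) and a density `ρ`,
`normConst t ρ = (Tρ)(0)` — the value of the transformed density at the zero block field `ψ = 0`.  In (2.18),
`Z^{(k),L^kε}(Ω,A) exp(−½⟨ψ,Δ^{(k+1)}ψ⟩) = T^{L^kε}_{a,L,A}[Ω^{(k)}, exp(−½⟨φ,Δ^{(k)}φ⟩)]` read at `ψ = 0` IS
`Z^{(k),L^kε}(Ω,A) = (T^{L^kε}_{a,L,A} exp(−½⟨·,Δ^{(k)}·⟩))(0)` (the Gaussian factor is `1` at `ψ = 0`); likewise (2.19) at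
`ψ = 0` gives `Z^ε_k(Ω,A) = (T^ε_{a_k,L^k,A} exp(−½⟨·,(−Δ^{ε,N}_{A,Ω}+m²)·⟩))(0)`.
[cite: Balaban1982Higgs1, (2.18)–(2.19) p.610] -/
noncomputable def normConst (t : (Y → V) → (X → V) → ℝ) (ρ : (X → V) → ℝ) : ℝ :=
  rtOp t ρ 0

/-- The transformed density divided by its normalisation factor — in (2.18)/(2.19) this is the Gaussian
`exp(−½⟨ψ,Δ^{(k+1),L^{k+1}ε}ψ⟩)`, resp. `exp(−½⟨ψ,Δ^{(k),L^kε}ψ⟩)`, which (2.18) DEFINES ("We define inductively").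
[cite: Balaban1982Higgs1, (2.18)–(2.19) p.610] -/
noncomputable def normShape (t : (Y → V) → (X → V) → ℝ) (ρ : (X → V) → ℝ) (ψ : Y → V) : ℝ :=
  rtOp t ρ ψ / normConst t ρ

omit [Fintype Y] in
/-- Unfolding lemma (definitional). [cite: Balaban1982Higgs1, (2.18) p.610] -/
theorem normConst_eq (t : (Y → V) → (X → V) → ℝ) (ρ : (X → V) → ℝ) : normConst t ρ = rtOp t ρ 0 := rfl

omit [Fintype Y] in
/-- Unfolding lemma (definitional). [cite: Balaban1982Higgs1, (2.18) p.610] -/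
theorem normShape_eq (t : (Y → V) → (X → V) → ℝ) (ρ : (X → V) → ℝ) (ψ : Y → V) :
    normShape t ρ ψ = rtOp t ρ ψ / normConst t ρ := rfl

omit [Fintype Y] in
/-- The operator (2.4) is linear: `T(c·ρ) = c·Tρ` (no integrability needed). [cite: Balaban1982Higgs1, (2.4) p.608] -/
theorem rtOp_const_mul (t : (Y → V) → (X → V) → ℝ) (c : ℝ) (ρ : (X → V) → ℝ) (ψ : Y → V) :
    rtOp t (fun φ => c * ρ φ) ψ = c * rtOp t ρ ψ := by
  simp only [rtOp_eq]
  rw [← integral_const_mul]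
  refine integral_congr_ae (Filter.Eventually.of_forall fun φ => ?_)
  simp only
  ring

omit [Fintype Y] in
/-- (2.18)/(2.19) as an identity of densities: `Tρ = Z · (Tρ/Z)` with `Z = (Tρ)(0) ≠ 0`, and the normalised density
is `1` at `ψ = 0`. [cite: Balaban1982Higgs1, (2.18)–(2.19) p.610] -/
theorem rtOp_eq_normConst_mul_normShape {t : (Y → V) → (X → V) → ℝ} {ρ : (X → V) → ℝ}
    (hZ : normConst t ρ ≠ 0) :
    (rtOp t ρ = fun ψ => normConst t ρ * normShape t ρ ψ) ∧ normShape t ρ 0 = 1 := by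
  refine ⟨funext fun ψ => ?_, ?_⟩
  · rw [normShape_eq, mul_div_cancel₀ _ hZ]
  · rw [normShape_eq, ← normConst_eq, div_self hZ]

/-- **(2.39) from (2.14), (2.18), (2.19)** — the "easy calculation", p. 612, for ANY three transformations (2.4)
`T₁ : X-fields → Y-fields`, `T₂ : Y-fields → W-fields`, `T₃ : X-fields → W-fields` with `T₂(T₁ρ) = T₃ρ` ((2.14)):
if `T₁ρ = Z₁·g` ((2.19): `Z₁ = Z^ε_k`, `g = exp(−½⟨ψ,Δ^{(k)}ψ⟩)`; `g(0) = 1` identifies `Z₁ = (T₁ρ)(0)` but is not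
used), then the normalisation factor of `T₃ρ` ((2.19) at k + 1: `Z^ε_{k+1}`) is `Z₁` times that of `T₂g` ((2.18):
`Z^{(k)}`): `Z^ε_{k+1} = Z^ε_k · Z^{(k),L^kε}`.  (Evaluate `T₃ρ = T₂(Z₁·g) = Z₁·T₂g` at `ψ = 0`.)
[cite: Balaban1982Higgs1, (2.39) p.612] -/
theorem normConst_comp [Fintype W] {t₁ : (Y → V) → (X → V) → ℝ} {t₂ : (W → V) → (Y → V) → ℝ}
    {t₃ : (W → V) → (X → V) → ℝ} {ρ : (X → V) → ℝ} {g : (Y → V) → ℝ} {Z₁ : ℝ}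
    (h219 : rtOp t₁ ρ = fun ψ => Z₁ * g ψ) (h214 : rtOp t₂ (rtOp t₁ ρ) = rtOp t₃ ρ) :
    normConst t₃ ρ = Z₁ * normConst t₂ g := by
  rw [normConst_eq, ← h214, h219, rtOp_const_mul, normConst_eq]

omit [Fintype X] [FiniteDimensional ℝ V] [MeasurableSpace V] [BorelSpace V] in
/-- The block kernel (2.5) is strictly positive (κ > 0). [cite: Balaban1982Higgs1, (2.5)–(2.6) p.608] -/
theorem blockKernel_pos {κ : ℝ} (hκ : 0 < κ) (m : (X → V) → Y → V) (ψ : Y → V) (φ : X → V) :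
    0 < blockKernel κ m ψ φ := by
  rw [blockKernel_eq]
  exact Finset.prod_pos fun y _ => rtKernel_pos hκ _

omit [Fintype X] in
/-- The block kernel (2.5) is measurable in the fine field for a measurable block-average map.
[cite: Balaban1982Higgs1, (2.5) p.608] -/
theorem measurable_blockKernel (κ : ℝ) {m : (X → V) → Y → V} (hm : Measurable m) (ψ : Y → V) :
    Measurable fun φ : X → V => blockKernel κ m ψ φ := by
  simp only [blockKernel_eq]
  refine Finset.measurable_prod _ fun y _ => (continuous_rtKernel κ).measurable.comp ?_
  exact measurable_const.sub ((measurable_pi_apply y).comp hm)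

/-- A renormalization transformation (2.4)–(2.5) of a non-negative integrable density of positive mass is a
STRICTLY POSITIVE function of the block field (the kernel (2.5) is a positive Gaussian): in particular the
normalisation factors (2.18)/(2.19) are positive numbers. [cite: Balaban1982Higgs1, (2.4)–(2.6) p.608, (2.18)–(2.19) p.610] -/
theorem rtOp_blockKernel_pos {κ : ℝ} (hκ : 0 < κ) {m : (X → V) → Y → V} (hm : Measurable m)
    {ρ : (X → V) → ℝ} (hρ : Integrable ρ) (hnn : ∀ φ, 0 ≤ ρ φ) (hmass : 0 < ∫ φ, ρ φ) (ψ : Y → V) :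
    0 < rtOp (blockKernel κ m) ρ ψ := by
  rw [rtOp_eq]
  have hsupp : 0 < volume (Function.support ρ) :=
    (integral_pos_iff_support_of_nonneg (fun φ => hnn φ) hρ).mp hmass
  have hint : Integrable fun φ : X → V => blockKernel κ m ψ φ * ρ φ := by
    refine Integrable.bdd_mul hρ (measurable_blockKernel κ hm ψ).aestronglyMeasurable
      (c := ∏ _y : Y, (κ / (2 * π)) ^ ((Module.finrank ℝ V : ℝ) / 2)) (Filter.Eventually.of_forall fun φ => ?_)
    rw [Real.norm_of_nonneg (blockKernel_nonneg hκ.le _ _ _), blockKernel_eq]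
    exact Finset.prod_le_prod (fun y _ => rtKernel_nonneg hκ.le _) fun y _ => rtKernel_le hκ.le _
  have hnn' : 0 ≤ fun φ : X → V => blockKernel κ m ψ φ * ρ φ := fun φ =>
    mul_nonneg (blockKernel_nonneg hκ.le _ _ _) (hnn φ)
  rw [integral_pos_iff_support_of_nonneg hnn' hint]
  have hs : Function.support (fun φ : X → V => blockKernel κ m ψ φ * ρ φ) = Function.support ρ := by
    rw [Function.support_mul]
    refine Set.inter_eq_right.mpr fun φ _ => ?_
    exact (blockKernel_pos hκ m ψ φ).ne'
  rwa [hs]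

/-- **(2.39)** p. 612 for the renormalization transformations of (2.14), KERNEL: with `T_k` the k-th order
transformation (kernel (2.10), precision β, block averages `m` = Q_k(A)), `T^{(k)}` the one-step transformation
(kernel (2.6), precision α, block average Q(A) = `qAvg w u`) and `T_{k+1} = T^{(k)}T_k` their composition ((2.14),
`B1RTSemigroup.display214`: precision `compPrec α β w |B|`, block average Q(A)Q_k(A)), for every integrable density
ρ (↤ exp(−½⟨φ,(−Δ^{ε,N}_{A,Ω}+m²)φ⟩)) whose factor `Z^ε_k = (T_kρ)(0)` is non-zero:
`Z^ε_{k+1} = Z^ε_k · Z^{(k),L^kε}`, where `Z^ε_{k+1} = (T_{k+1}ρ)(0)` ((2.19) at k + 1) and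
`Z^{(k),L^kε} = (T^{(k)} g_k)(0)` ((2.18)) with `g_k = T_kρ / Z^ε_k` the normalised k-th density ((2.19):
`exp(−½⟨ψ,Δ^{(k),L^kε}ψ⟩)`). [cite: Balaban1982Higgs1, (2.39) p.612] -/
theorem display239 {Z B : Type*} [Fintype Z] [Fintype B] {α β : ℝ} (hα : 0 < α) (hβ : 0 < β) (w : ℝ)
    (u : Z × B → (V ≃ₗᵢ[ℝ] V)) {m : (X → V) → Z × B → V} (hm : Measurable m) {ρ : (X → V) → ℝ}
    (hρ : Integrable ρ) (hZ : normConst (blockKernel β m) ρ ≠ 0) :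
    normConst (blockKernel (compPrec α β w (Fintype.card B)) (fun φ => qAvg w u (m φ))) ρ
      = normConst (blockKernel β m) ρ
          * normConst (blockKernel α (qAvg w u)) (normShape (blockKernel β m) ρ) :=
  normConst_comp (rtOp_eq_normConst_mul_normShape hZ).1 (display214 hα hβ w u hm hρ)

/-- (2.39) with the non-vanishing of `Z^ε_k` DISCHARGED: for a non-negative integrable density of positive mass (the
Gaussian density exp(−½⟨φ,(−Δ^{ε,N}_{A,Ω}+m²)φ⟩) of (2.17)/(2.19) is one) all factors are positive and
`Z^ε_{k+1} = Z^ε_k · Z^{(k),L^kε}`. [cite: Balaban1982Higgs1, (2.39) p.612] -/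
theorem display239_of_nonneg {Z B : Type*} [Fintype Z] [Fintype B] {α β : ℝ} (hα : 0 < α) (hβ : 0 < β)
    (w : ℝ) (u : Z × B → (V ≃ₗᵢ[ℝ] V)) {m : (X → V) → Z × B → V} (hm : Measurable m) {ρ : (X → V) → ℝ}
    (hρ : Integrable ρ) (hnn : ∀ φ, 0 ≤ ρ φ) (hmass : 0 < ∫ φ, ρ φ) :
    normConst (blockKernel (compPrec α β w (Fintype.card B)) (fun φ => qAvg w u (m φ))) ρ
      = normConst (blockKernel β m) ρ
          * normConst (blockKernel α (qAvg w u)) (normShape (blockKernel β m) ρ) :=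
  display239 hα hβ w u hm hρ (rtOp_blockKernel_pos hβ hm hρ hnn hmass 0).ne'

end Operator

/-! ## §1′  (2.40): the factors of a chain of k transformations multiply -/

section Chain

open B1RT B1RTSemigroup

universe u

variable {V : Type*} [NormedAddCommGroup V] [InnerProductSpace ℝ V] [FiniteDimensional ℝ V]
  [MeasurableSpace V] [BorelSpace V]
variable {B : Type u} [Fintype B]

/-- **The factors Z^{(k−1)}, …, Z^{(1)}, Z^{(0)} of (2.40)** along a chain of n one-step transformations (the left side
of (2.16), `B1RTSemigroup.rtChain`, coarsest step LAST) applied to a density ρ of the finest fields, listed coarsest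
first as printed: the head is the factor (2.18) of the coarsest step — that step applied to the NORMALISED output of the
inner (n−1)-chain (by (2.19) = exp(−½⟨ψ,Δ^{(n−1)}ψ⟩)), evaluated at ψ = 0 —, the tail is the list of the inner chain.
[cite: Balaban1982Higgs1, (2.18) p.610, (2.40) p.612] -/
noncomputable def chainConsts (w : ℝ) : (n : ℕ) → (κ : ℕ → ℝ) → (Z : Type u) → [Fintype Z] →
    ((j : ℕ) → Sites B Z j × B → (V ≃ₗᵢ[ℝ] V)) → ((Sites B Z n → V) → ℝ) → List ℝ
  | 0, _, _, _, _, _ => []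
  | n + 1, κ, Z, _, u, ρ =>
      normConst (blockKernel (κ 0) (qAvg w (u 0)))
          (fun θ => rtChain w n (fun j => κ (j + 1)) (Z × B) (fun j => u (j + 1)) ρ θ
            / rtChain w n (fun j => κ (j + 1)) (Z × B) (fun j => u (j + 1)) ρ 0)
        :: chainConsts w n (fun j => κ (j + 1)) (Z × B) (fun j => u (j + 1)) ρ

/-- No step, no factor. [cite: Balaban1982Higgs1, (2.40) p.612] -/
theorem chainConsts_zero (w : ℝ) (κ : ℕ → ℝ) (Z : Type u) [Fintype Z]
    (u : (j : ℕ) → Sites B Z j × B → (V ≃ₗᵢ[ℝ] V)) (ρ : (Sites B Z 0 → V) → ℝ) :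
    chainConsts w 0 κ Z u ρ = [] := rfl


/-- The value at ψ = 0 of a chain applied to a non-negative integrable density of positive mass with ρ(0) > 0 is
positive: for n = 0 it is ρ(0), for n ≥ 1 the chain is one Gaussian transformation (`B1RTSemigroup.rtChain_succ_eq`)
and `rtOp_blockKernel_pos` applies. [cite: Balaban1982Higgs1, (2.16) p.609, (2.19) p.610] -/
theorem rtChain_apply_zero_pos (w : ℝ) : ∀ (n : ℕ) (κ : ℕ → ℝ) (_hκ : ∀ j, 0 < κ j) (Z : Type u) [Fintype Z]
    (u : (j : ℕ) → Sites B Z j × B → (V ≃ₗᵢ[ℝ] V)) (ρ : (Sites B Z n → V) → ℝ) (_hρ : Integrable ρ)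
    (_hnn : ∀ φ, 0 ≤ ρ φ) (_hmass : 0 < ∫ φ, ρ φ) (_h0 : 0 < ρ 0), 0 < rtChain w n κ Z u ρ 0
  | 0, _, _, _, _, _, _, _, _, _, h0 => h0
  | n + 1, κ, hκ, Z, _, u, ρ, hρ, hnn, hmass, _ => by
      rw [rtChain_succ_eq w n κ hκ Z u ρ hρ]
      exact rtOp_blockKernel_pos (chainPrec_pos w _ (n + 1) κ hκ)
        (continuous_chainAvg w (n + 1) Z u).measurable hρ hnn hmass 0

/-- **(2.39) along a chain**: the value at 0 of the (n+1)-chain is the value at 0 of the inner n-chain (`Z^ε_n`) times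
the factor (2.18) of the coarsest step applied to the normalised inner output (`Z^{(n)}`) — linearity of (2.4).
[cite: Balaban1982Higgs1, (2.39) p.612] -/
theorem rtChain_succ_apply_zero (w : ℝ) (n : ℕ) (κ : ℕ → ℝ) (Z : Type u) [Fintype Z]
    (u : (j : ℕ) → Sites B Z j × B → (V ≃ₗᵢ[ℝ] V)) (ρ : (Sites B Z (n + 1) → V) → ℝ)
    (hin : rtChain w n (fun j => κ (j + 1)) (Z × B) (fun j => u (j + 1)) ρ 0 ≠ 0) :
    rtChain w (n + 1) κ Z u ρ 0
      = rtChain w n (fun j => κ (j + 1)) (Z × B) (fun j => u (j + 1)) ρ 0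
          * normConst (blockKernel (κ 0) (qAvg w (u 0)))
              (fun θ => rtChain w n (fun j => κ (j + 1)) (Z × B) (fun j => u (j + 1)) ρ θ
                / rtChain w n (fun j => κ (j + 1)) (Z × B) (fun j => u (j + 1)) ρ 0) := by
  set inner := rtChain w n (fun j => κ (j + 1)) (Z × B) (fun j => u (j + 1)) ρ with hinner
  have hsplit : (fun θ => inner 0 * (inner θ / inner 0)) = inner :=
    funext fun θ => mul_div_cancel₀ _ hin
  rw [rtChain_succ, ← hinner, normConst_eq]
  conv_lhs => rw [← hsplit]
  exact rtOp_const_mul _ _ _ _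

/-- **(2.40) in general form**, KERNEL: for a chain of n one-step transformations with positive precisions applied to a
non-negative integrable density ρ of positive mass with ρ(0) > 0, the value at ψ = 0 of the output is ρ(0) times the
product of the n factors (2.18) `chainConsts` (coarsest first): `(T^{(n−1)}⋯T^{(0)}ρ)(0) = ρ(0)·Z^{(n−1)}⋯Z^{(0)}`.
Induction on n, each step being (2.39) (`rtChain_succ_apply_zero`). [cite: Balaban1982Higgs1, (2.40) p.612] -/
theorem rtChain_apply_zero_eq_prod (w : ℝ) : ∀ (n : ℕ) (κ : ℕ → ℝ) (_hκ : ∀ j, 0 < κ j) (Z : Type u) [Fintype Z]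
    (u : (j : ℕ) → Sites B Z j × B → (V ≃ₗᵢ[ℝ] V)) (ρ : (Sites B Z n → V) → ℝ) (_hρ : Integrable ρ)
    (_hnn : ∀ φ, 0 ≤ ρ φ) (_hmass : 0 < ∫ φ, ρ φ) (_h0 : 0 < ρ 0),
    rtChain w n κ Z u ρ 0 = ρ 0 * (chainConsts w n κ Z u ρ).prod
  | 0, κ, _, Z, _, u, ρ, _, _, _, _ => by
      rw [rtChain_zero, chainConsts_zero, List.prod_nil, mul_one]
      rfl
  | n + 1, κ, hκ, Z, _, u, ρ, hρ, hnn, hmass, h0 => by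
      have ih := rtChain_apply_zero_eq_prod w n (fun j => κ (j + 1)) (fun j => hκ (j + 1)) (Z × B)
        (fun j => u (j + 1)) ρ hρ hnn hmass h0
      have hin := (rtChain_apply_zero_pos w n (fun j => κ (j + 1)) (fun j => hκ (j + 1)) (Z × B)
        (fun j => u (j + 1)) ρ hρ hnn hmass h0).ne'
      rw [rtChain_succ_apply_zero w n κ Z u ρ hin, chainConsts, List.prod_cons]
      set c := normConst (blockKernel (κ 0) (qAvg w (u 0)))
        (fun θ => rtChain w n (fun j => κ (j + 1)) (Z × B) (fun j => u (j + 1)) ρ θ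
          / rtChain w n (fun j => κ (j + 1)) (Z × B) (fun j => u (j + 1)) ρ 0) with hc
      rw [ih, mul_assoc, mul_comm _ c]
      rfl

/-- **(2.40)** p. 612, KERNEL, for the printed data: on the tower of lattices with |B| = L^d positions per block, block
weight L^{−d} and kernel constants a(L^jε)^{d−2} (so that the k-chain IS `T^ε_{a_k,L^k,A}`, (2.16) =
`B1RTSemigroup.display216`), for every non-negative integrable density ρ of positive mass with ρ(0) = 1 (the Gaussian
exp(−½⟨φ,(−Δ^{ε,N}_{A,Ω}+m²)φ⟩) of (2.17)/(2.19) is one):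
`Z^ε_k = (T^ε_{a_k,L^k,A}ρ)(0) = Z^{(k−1),L^{k−1}ε}·…·Z^{(1),Lε}Z^{(0),ε}`, the factors being the list `chainConsts`
(each = the one-step transformation applied to the normalised previous density, at ψ = 0, (2.18)); a, ε > 0, L > 1,
k ≥ 1. [cite: Balaban1982Higgs1, (2.40) p.612] -/
theorem display240 {a : ℝ} {L : ℕ} {ε : ℝ} (ha : 0 < a) (hL : 1 < L) (hε : 0 < ε) {d : ℕ}
    (hB : Fintype.card B = L ^ d) {k : ℕ} (hk : 1 ≤ k) (Z : Type u) [Fintype Z]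
    (u : (j : ℕ) → Sites B Z j × B → (V ≃ₗᵢ[ℝ] V)) (ρ : (Sites B Z k → V) → ℝ) (hρ : Integrable ρ)
    (hnn : ∀ φ, 0 ≤ ρ φ) (hmass : 0 < ∫ φ, ρ φ) (h0 : ρ 0 = 1) :
    normConst (blockKernel (prec (B1.aSeq a L k) ((L : ℝ) ^ k * ε) d) (chainAvg (((L : ℝ) ^ d)⁻¹) k Z u)) ρ
      = (chainConsts (((L : ℝ) ^ d)⁻¹) k (precSeq a L ε d k) Z u ρ).prod := by
  have hL0 : 0 < L := lt_trans Nat.zero_lt_one hL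
  rw [normConst_eq, ← display216 ha hL hε hB hk Z u ρ hρ,
    rtChain_apply_zero_eq_prod _ k _ (fun j => precSeq_pos ha hL0 hε d k j) Z u ρ hρ hnn hmass
      (by rw [h0]; exact one_pos), h0, one_mul]

end Chain

/-! ## §2  (2.39) at the level of the Gaussian closed forms: a Schur-complement determinant identity over
`B1RG242.StepData` -/

section Determinant

open Matrix B1RG242

variable {𝕜 : Type*} [Field 𝕜] {ι κ ν : Type*}
variable [Fintype ι] [Fintype κ] [Fintype ν] [DecidableEq ι] [DecidableEq κ] [DecidableEq ν]
variable (S : StepData 𝕜 ι κ ν)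

/-- The matrix of the quadratic form of the COMPOSITE integrand `T^{(k)}T^ε_{a_k,L^k,A}[exp(−½⟨φ,Hφ⟩)]` ((2.18) after
(2.19)) in the variables (φ, θ) = (ε-lattice field, L^kε-lattice field) at ψ = 0, operator coordinates of
`B1RG242.StepData` (H = −Δ^{ε,N}_{A,Ω} + m², α = a_k(L^kε)^{−2}, β = a(L^{k+1}ε)^{−2}):
`⟨φ,Hφ⟩ + α⟨θ − Q_kφ, θ − Q_kφ⟩ + β⟨Qθ, Qθ⟩ = ⟨(φ,θ), 𝕄(φ,θ)⟩`,
`𝕄 = [[H + αP_k, −αQ^*_k], [−αQ_k, α·1 + βP]]` (P_k = Q^*_kQ_k, P = Q^*Q, (2.20)/(2.30)).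
[cite: Balaban1982Higgs1, (2.10) p.609, (2.18)–(2.20) p.610] -/
def jointForm : Matrix (ι ⊕ κ) (ι ⊕ κ) 𝕜 :=
  Matrix.fromBlocks (S.H + S.α • S.Pk) (-(S.α • S.Qks)) (-(S.α • S.Qk)) (S.α • (1 : Matrix κ κ 𝕜) + S.β • S.P)

omit [DecidableEq ν] in
/-- Integrating φ FIRST (the order (2.19) then (2.18)): the Schur complement of the block H + αP_k = (G^ε_k)⁻¹ is
`α·1 + βP − α²Q_kG^ε_kQ^*_k = βP + Δ^{(k)}` = (C^{(k),L^kε})⁻¹ ((2.21), (2.30)), so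
`det 𝕄 = det(H + αP_k) · det(βP + Δ^{(k)})` when H + αP_k is invertible. [cite: Balaban1982Higgs1, (2.21) p.610, (2.30) p.611] -/
theorem det_jointForm_fst (hG : IsUnit (S.H + S.α • S.Pk)) :
    (jointForm S).det = (S.H + S.α • S.Pk).det * (S.β • S.P + S.Δk).det := by
  have hdet : IsUnit (S.H + S.α • S.Pk).det := (Matrix.isUnit_iff_isUnit_det _).mp hG
  letI : Invertible (S.H + S.α • S.Pk) := Matrix.invertibleOfIsUnitDet _ hdet
  have hinv : ⅟(S.H + S.α • S.Pk) = S.Gk := Matrix.invOf_eq_nonsing_inv _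
  rw [jointForm, Matrix.det_fromBlocks₁₁, hinv]
  congr 2
  simp only [StepData.Δk, Matrix.neg_mul, Matrix.mul_neg, smul_neg, neg_neg, Matrix.smul_mul, Matrix.mul_smul,
    smul_smul]
  rw [← sq]
  abel

omit [Fintype ι] [DecidableEq ι] in
/-- The inverse of α·1 + βP for the projection P = Q^*Q (QQ^* = 1): `(α·1 + βP)(α⁻¹(1 − P) + (α+β)⁻¹P) = 1`
(α ≠ 0, α + β ≠ 0) — the one-block covariance algebra behind (2.12)–(2.13). [cite: Balaban1982Higgs1, (2.12)–(2.13) p.609] -/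
theorem smul_one_add_smul_P_mul (hQ : S.Q * S.Qs = 1) (hα : S.α ≠ 0) (hαβ : S.α + S.β ≠ 0) :
    (S.α • (1 : Matrix κ κ 𝕜) + S.β • S.P) * (S.α⁻¹ • (1 - S.P) + (S.α + S.β)⁻¹ • S.P) = 1 := by
  have hP := S.P_mul_P hQ
  simp only [Matrix.add_mul, Matrix.mul_add, Matrix.smul_mul, Matrix.mul_smul, Matrix.one_mul,
    Matrix.mul_one, Matrix.mul_sub, hP, smul_sub]
  match_scalars <;> first | (field_simp; done) | (field_simp; ring)

omit [Fintype ι] [DecidableEq ι] in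
/-- `det(α·1 + βQ^*Q)·α^{|ν|} = α^{|κ|}(α + β)^{|ν|}` for QQ^* = 1_ν (Weinstein–Aronszajn, `Matrix.det_one_add_mul_comm`:
the θ-marginal of the composite Gaussian — the constants of (2.12); |κ| = number of θ-variables, |ν| = number of
ψ-variables), α ≠ 0. [cite: Balaban1982Higgs1, (2.12)–(2.13) p.609] -/
theorem det_smul_one_add_smul_P (hQ : S.Q * S.Qs = 1) (hα : S.α ≠ 0) :
    (S.α • (1 : Matrix κ κ 𝕜) + S.β • S.P).det * S.α ^ Fintype.card ν
      = S.α ^ Fintype.card κ * (S.α + S.β) ^ Fintype.card ν := by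
  have h1 : S.α • (1 : Matrix κ κ 𝕜) + S.β • S.P = S.α • (1 + ((S.β / S.α) • S.Qs) * S.Q) := by
    rw [StepData.P, smul_add, Matrix.smul_mul, smul_smul, mul_div_cancel₀ _ hα]
  have h2 : (1 : Matrix ν ν 𝕜) + S.Q * ((S.β / S.α) • S.Qs) = (1 + S.β / S.α) • (1 : Matrix ν ν 𝕜) := by
    rw [Matrix.mul_smul, hQ, add_smul, one_smul]
  rw [h1, Matrix.det_smul, Matrix.det_one_add_mul_comm, h2, Matrix.det_smul, Matrix.det_one, mul_one,
    mul_assoc, ← mul_pow, add_mul, one_mul, div_mul_cancel₀ _ hα]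

/-- Integrating θ FIRST: the Schur complement of the block α·1 + βP is
`H + αP_k − α²Q^*_k(α·1 + βP)⁻¹Q_k = H + γP_{k+1}` = (G^ε_{k+1})⁻¹ with γ = αβ/(α + β) = a_{k+1}(L^{k+1}ε)^{−2} ((2.13),
`B1RG242.StepData.γ_printed`) and P_{k+1} = Q^*_kQ^*QQ_k ((2.20) at k + 1) — the operator content of (2.12)/(2.14) —, so
`det 𝕄 = det(α·1 + βP) · det(H + γP_{k+1})` (QQ^* = 1, α ≠ 0, α + β ≠ 0). [cite: Balaban1982Higgs1, (2.12)–(2.14) p.609, (2.20) p.610] -/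
theorem det_jointForm_snd (hQ : S.Q * S.Qs = 1) (hα : S.α ≠ 0) (hαβ : S.α + S.β ≠ 0) :
    (jointForm S).det = (S.α • (1 : Matrix κ κ 𝕜) + S.β • S.P).det * (S.H + S.γ • S.Pk1).det := by
  letI : Invertible (S.α • (1 : Matrix κ κ 𝕜) + S.β • S.P) :=
    invertibleOfRightInverse _ _ (smul_one_add_smul_P_mul S hQ hα hαβ)
  have hinv : ⅟(S.α • (1 : Matrix κ κ 𝕜) + S.β • S.P) = S.α⁻¹ • (1 - S.P) + (S.α + S.β)⁻¹ • S.P := rfl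
  rw [jointForm, Matrix.det_fromBlocks₂₂, hinv]
  congr 2
  have hP := S.P_mul_P hQ
  simp only [StepData.Pk1, StepData.Qk1, StepData.Qk1s, StepData.Pk, StepData.γ, Matrix.neg_mul,
    Matrix.mul_neg, smul_neg, Matrix.smul_mul, Matrix.mul_smul, Matrix.mul_add, Matrix.add_mul,
    Matrix.mul_sub,
    Matrix.sub_mul, Matrix.mul_one, smul_sub, smul_add, smul_smul, Matrix.mul_assoc, StepData.P]
  match_scalars <;> first | (field_simp; done) | (field_simp; ring)

/-- **(2.39) AT DETERMINANT LEVEL** ("Schur-complement determinant"), KERNEL, over any field and any finite carriers: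
`det(H + αP_k) · det(βP + Δ^{(k)}) · α^{|ν|} = α^{|κ|}(α + β)^{|ν|} · det(H + γP_{k+1})`
— i.e. `det (G^ε_k)⁻¹ · det (C^{(k),L^kε})⁻¹ · α^{|ν|} = α^{|κ|}(α+β)^{|ν|} · det (G^ε_{k+1})⁻¹` —, under QQ^* = 1, α ≠ 0,
α + β ≠ 0 and the invertibility of H + αP_k (the two Schur expansions of `det 𝕄`, `det_jointForm_fst` =
`det_jointForm_snd`, and `det_smul_one_add_smul_P`).  With the Gaussian closed forms of (2.18)/(2.19) (§3:
`Z = (c/2π)^{n_out/2}(2π)^{n_in/2}(det M)^{−1/2}`) and γ(α + β) = αβ this IS `Z^ε_{k+1} = Z^ε_k Z^{(k),L^kε}`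
(`zConst_display239`).  The invertibility of βP + Δ^{(k)} ((2.30), "It is so") is NOT assumed: it follows whenever the
right side is non-zero. [cite: Balaban1982Higgs1, (2.39) p.612] -/
theorem det_display239 (hQ : S.Q * S.Qs = 1) (hα : S.α ≠ 0) (hαβ : S.α + S.β ≠ 0)
    (hG : IsUnit (S.H + S.α • S.Pk)) :
    (S.H + S.α • S.Pk).det * (S.β • S.P + S.Δk).det * S.α ^ Fintype.card ν
      = S.α ^ Fintype.card κ * (S.α + S.β) ^ Fintype.card ν * (S.H + S.γ • S.Pk1).det := by
  rw [← det_jointForm_fst S hG, det_jointForm_snd S hQ hα hαβ, mul_comm _ (S.H + S.γ • S.Pk1).det, mul_assoc,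
    det_smul_one_add_smul_P S hQ hα]
  ring

end Determinant

/-! ## §3  The Gaussian closed forms of (2.18)/(2.19) and (2.39) for them -/

section ClosedForm

open Matrix B1RG242

variable {ι : Type*} [Fintype ι] [DecidableEq ι]

omit [DecidableEq ι] in
/-- **(2.18)/(2.19) at ψ = 0 in integration coordinates**: a transformation whose single-site kernel (2.6)/(2.10) has
the prefactor `(c/2π)^{N/2}` per output site (c = a(L^{k+1}ε)^{d−2}, resp. a_k(L^kε)^{d−2}), with `nOut` = N·(number of
output sites) real output variables, applied to a centred Gaussian density and evaluated at ψ = 0, is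
`(c/2π)^{nOut/2} ∫ dv exp(−½ vᵀMv)`, M the matrix of the full exponent at ψ = 0 on the `|ι|` real input variables
(for (2.19): M = matrix of ⟨φ,(H + αP_k)φ⟩ = ⟨φ,(G^ε_k)⁻¹φ⟩, cf. (3.31)–(3.32) p. 617; for (2.18): of ⟨θ,(βP + Δ^{(k)})θ⟩
= ⟨θ,(C^{(k),L^kε})⁻¹θ⟩, (2.30)).  For nOut = |ι| this is, definitionally, seat p12's `B1GaussNorm331.gaussNorm` (same body; that module is not
imported here).
[cite: Balaban1982Higgs1, (2.18)–(2.19) p.610, (3.31)–(3.32) p.617] -/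
noncomputable def zConst (c : ℝ) (nOut : ℕ) (M : Matrix ι ι ℝ) : ℝ :=
  (c / (2 * π)) ^ ((nOut : ℝ) / 2) * ∫ v : ι → ℝ, Real.exp (-(1 / 2 : ℝ) * (v ⬝ᵥ M *ᵥ v))

omit [DecidableEq ι] in
/-- Unfolding lemma (definitional). [cite: Balaban1982Higgs1, (2.18)–(2.19) p.610] -/
theorem zConst_eq (c : ℝ) (nOut : ℕ) (M : Matrix ι ι ℝ) :
    zConst c nOut M = (c / (2 * π)) ^ ((nOut : ℝ) / 2) * ∫ v : ι → ℝ, Real.exp (-(1 / 2 : ℝ) * (v ⬝ᵥ M *ᵥ v)) :=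
  rfl

/-- **The closed form**: `zConst c n M = (c/2π)^{n/2} · √(2π)^{|ι|} / √(det M)` for M positive definite — the tree's
KERNEL theorem `Beta.GaussianIntegral.integral_exp_neg_half_quadForm`, by name ("calculating the integral in (2.19)").
[cite: Balaban1982Higgs1, (2.18)–(2.21) p.610] -/
theorem zConst_closedForm (c : ℝ) (nOut : ℕ) {M : Matrix ι ι ℝ} (hM : M.PosDef) :
    zConst c nOut M = (c / (2 * π)) ^ ((nOut : ℝ) / 2) * (Real.sqrt (2 * π) ^ Fintype.card ι / Real.sqrt M.det) := by
  rw [zConst, Beta.GaussianIntegral.integral_exp_neg_half_quadForm M hM]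

/-- Positivity of the closed form (c > 0, M positive definite): the factors (2.18)/(2.19) are positive numbers.
[cite: Balaban1982Higgs1, (2.18)–(2.19) p.610] -/
theorem zConst_pos {c : ℝ} (hc : 0 < c) (nOut : ℕ) {M : Matrix ι ι ℝ} (hM : M.PosDef) : 0 < zConst c nOut M := by
  rw [zConst_closedForm c nOut hM]
  have h1 : 0 < (c / (2 * π)) ^ ((nOut : ℝ) / 2) := Real.rpow_pos_of_pos (by positivity) _
  have h2 : 0 < Real.sqrt (2 * π) ^ Fintype.card ι := pow_pos (Real.sqrt_pos.2 (by positivity)) _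
  exact mul_pos h1 (div_pos h2 (Real.sqrt_pos.2 hM.det_pos))

/-- The square of the closed form: `(zConst c n M)² = c^n (2π)^{|ι|} / ((2π)^n det M)` (c ≥ 0, M positive
definite) — the form in which (2.39) is checked below. [cite: Balaban1982Higgs1, (2.18)–(2.19) p.610, (2.39) p.612] -/
theorem zConst_sq {c : ℝ} (hc : 0 ≤ c) (nOut : ℕ) {M : Matrix ι ι ℝ} (hM : M.PosDef) :
    zConst c nOut M ^ 2 = c ^ nOut * (2 * π) ^ Fintype.card ι / ((2 * π) ^ nOut * M.det) := by
  have h2π : (0 : ℝ) ≤ 2 * π := by positivity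
  have hc' : 0 ≤ c / (2 * π) := div_nonneg hc h2π
  have hr : ((c / (2 * π)) ^ ((nOut : ℝ) / 2)) ^ 2 = (c / (2 * π)) ^ nOut := by
    rw [← Real.rpow_natCast ((c / (2 * π)) ^ ((nOut : ℝ) / 2)) 2, ← Real.rpow_mul hc', Nat.cast_ofNat,
      div_mul_cancel₀ (nOut : ℝ) two_ne_zero, Real.rpow_natCast]
  have hs : (Real.sqrt (2 * π) ^ Fintype.card ι) ^ 2 = (2 * π) ^ Fintype.card ι := by
    rw [← pow_mul, mul_comm (Fintype.card ι) 2, pow_mul, Real.sq_sqrt h2π]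
  rw [zConst_closedForm c nOut hM, mul_pow, div_pow, hr, hs, Real.sq_sqrt hM.det_pos.le, div_pow,
    div_mul_div_comm]

variable {κ ν : Type*} [Fintype κ] [Fintype ν] [DecidableEq κ] [DecidableEq ν]

/-- **(2.39) FOR THE GAUSSIAN CLOSED FORMS**, KERNEL: let S be the step data of `B1RG242` over ℝ with QQ^* = 1 and
α, β > 0, let the scalar products (1.5) of the ε- and L^kε-lattices have matrices `WE` resp. `wK·1` in the integration
coordinates (wK = (L^kε)^d) and let wM = (L^{k+1}ε)^d, so that the kernel constants (2.10)/(2.6) are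
a_k(L^kε)^{d−2} = α·wK, a(L^{k+1}ε)^{d−2} = β·wM, a_{k+1}(L^{k+1}ε)^{d−2} = γ·wM; assume the three forms
`WE(H + αP_k)` (of (2.19) at ψ = 0), `wK(βP + Δ^{(k)})` (of (2.18) at ψ = 0), `WE(H + γP_{k+1})` (of (2.19) at k + 1)
are positive definite.  Then, with |κ| = N|Ω^{(k)}| output variables of T_k and |ν| = N|Ω^{(k+1)}| of T^{(k)}, T_{k+1}:
`Z^ε_k · Z^{(k),L^kε} = Z^ε_{k+1}` for the closed forms `zConst` — by `det_display239` and γ(α + β) = αβ; the powers of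
2π cancel exactly. [cite: Balaban1982Higgs1, (2.39) p.612] -/
theorem zConst_display239 (S : StepData ℝ ι κ ν) {WE : Matrix ι ι ℝ} {wK wM : ℝ} (hwK : 0 < wK) (hwM : 0 < wM)
    (hQ : S.Q * S.Qs = 1) (hα : 0 < S.α) (hβ : 0 < S.β)
    (hMk : (WE * (S.H + S.α • S.Pk)).PosDef) (hMs : (wK • (S.β • S.P + S.Δk)).PosDef)
    (hMk1 : (WE * (S.H + S.γ • S.Pk1)).PosDef) :
    zConst (S.α * wK) (Fintype.card κ) (WE * (S.H + S.α • S.Pk))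
        * zConst (S.β * wM) (Fintype.card ν) (wK • (S.β • S.P + S.Δk))
      = zConst (S.γ * wM) (Fintype.card ν) (WE * (S.H + S.γ • S.Pk1)) := by
  -- abbreviations
  set A := S.H + S.α • S.Pk with hA
  set C := S.β • S.P + S.Δk with hC
  set Bm := S.H + S.γ • S.Pk1 with hBm
  set n := Fintype.card κ with hn
  set m := Fintype.card ν with hm
  set i := Fintype.card ι with hi
  have hαβ : S.α + S.β ≠ 0 := (add_pos hα hβ).ne'
  have hγpos : 0 < S.γ := by rw [StepData.γ]; positivity
  -- determinants
  have hdetMk : (WE * A).det = WE.det * A.det := Matrix.det_mul _ _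
  have hdetMs : (wK • C).det = wK ^ n * C.det := by rw [Matrix.det_smul]
  have hdetMk1 : (WE * Bm).det = WE.det * Bm.det := Matrix.det_mul _ _
  have hMk_pos := hMk.det_pos
  have hMs_pos := hMs.det_pos
  have hMk1_pos := hMk1.det_pos
  rw [hdetMk] at hMk_pos
  rw [hdetMs] at hMs_pos
  rw [hdetMk1] at hMk1_pos
  have hAdet : A.det ≠ 0 := fun h => by rw [h, mul_zero] at hMk_pos; exact lt_irrefl _ hMk_pos
  have hCdet : C.det ≠ 0 := fun h => by rw [h, mul_zero] at hMs_pos; exact lt_irrefl _ hMs_pos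
  have hBdet : Bm.det ≠ 0 := fun h => by rw [h, mul_zero] at hMk1_pos; exact lt_irrefl _ hMk1_pos
  have hWE : WE.det ≠ 0 := fun h => by rw [h, zero_mul] at hMk_pos; exact lt_irrefl _ hMk_pos
  have hG : IsUnit (S.H + S.α • S.Pk) :=
    (Matrix.isUnit_iff_isUnit_det _).mpr (isUnit_iff_ne_zero.mpr hAdet)
  -- the determinant identity (2.39) and γ(α+β) = αβ, combined
  have hdet := det_display239 S hQ hα.ne' hαβ hG
  have hγm : S.γ ^ m * (S.α + S.β) ^ m = S.α ^ m * S.β ^ m := by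
    rw [← mul_pow, S.γ_mul hαβ, mul_pow]
  have key : S.α ^ n * S.β ^ m * Bm.det = S.γ ^ m * (A.det * C.det) := by
    refine mul_right_cancel₀ (pow_ne_zero m hαβ) ?_
    linear_combination (-(A.det * C.det)) * hγm + (-(S.β ^ m)) * hdet
  -- compare squares of positive numbers
  have hL1 := zConst_pos (mul_pos hα hwK) n hMk
  have hL2 := zConst_pos (mul_pos hβ hwM) m hMs
  have hR := zConst_pos (mul_pos hγpos hwM) m hMk1
  have h2π : (0 : ℝ) < 2 * π := by positivity
  rw [← pow_left_inj₀ (mul_pos hL1 hL2).le hR.le two_ne_zero, mul_pow,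
    zConst_sq (mul_pos hα hwK).le n hMk, zConst_sq (mul_pos hβ hwM).le m hMs,
    zConst_sq (mul_pos hγpos hwM).le m hMk1, hdetMk, hdetMs, hdetMk1, div_mul_div_comm,
    div_eq_div_iff (mul_ne_zero (mul_ne_zero (pow_ne_zero _ h2π.ne') hMk_pos.ne')
      (mul_ne_zero (pow_ne_zero _ h2π.ne') hMs_pos.ne')) (mul_ne_zero (pow_ne_zero _ h2π.ne') hMk1_pos.ne')]
  linear_combination (wK ^ n * wM ^ m * (2 * π) ^ i * (2 * π) ^ n * (2 * π) ^ m * WE.det) * key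

end ClosedForm

end Literature.MathematicalPhysics.QuantumFieldTheory.Balaban1983to89.B1Eq239Normalization
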